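import Mathlib
import Literature.Probability.LatticeModels.ThermodynamicLimit
import HarnessLib

/-!
# Stub `stub_scaleIdentity` of line `diffusive-branch-is-nonsaturation` (crux
# `PrecisionLaplacian.DirectCorrelationStableTail`, stmt-CriticalPhenomena-4799): the scale identity

**Statement** (registered text).  Let `m ∈ ℓ¹(ℤ³)` with `Σ_y m(y) = 0` be the precision row of a
kernel `G : ℤ³ → [0, 1]`, `G` even, i.e. `Σ_y m(y) G(z − y) = −δ_{z,0}` for every `z ∈ ℤ³`.  Let
`φ : ℝ³ → ℝ` be even with `|φ| ≤ 1` and such that the rescaled family `z ↦ φ(z/R)` is summable over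
`ℤ³`, and let `Ψ(y) = Σ_z φ(z/R) G(z − y)` be the smeared kernel.  Then the series
`Σ_y m(y) (Ψ(0) − Ψ(y))` is summable, its value is `φ(0)` (the *scale identity*), and `Ψ` is even.

**Proof.**  Pure `tsum` algebra.  The double family `F(z, y) = φ(z/R) · m(y) · G(z − y)` is
absolutely summable on `ℤ³ × ℤ³`, being dominated by the product `|φ(z/R)| · |m(y)|` of two summable
non-negative families (`|G| ≤ 1`).  Fubini (`Summable.tsum_comm`) gives
`Σ_y m(y) Ψ(y) = Σ_y Σ_z F = Σ_z Σ_y F = Σ_z φ(z/R) (Σ_y m(y) G(z − y)) = Σ_z φ(z/R) (−δ_{z,0}) = −φ(0)`,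
while `Σ_y m(y) Ψ(0) = Ψ(0) Σ_y m(y) = 0`; subtracting, `Σ_y m(y)(Ψ(0) − Ψ(y)) = φ(0)`.  Evenness of
`Ψ` follows by re-indexing `z ↦ −z` (`Equiv.tsum_eq` for `Equiv.neg`) using that `φ` and `G` are even.
Nothing uses `R > 0`.  Pure theorem file, no definitions, no `sorry`.  References: folklore.
-/

noncomputable section

namespace Summit.CriticalPhenomena.Ising3DConformalLimit.Cruxes.DirectCorrelationStableTail.DiffusiveBranchIsNonsaturation

open MeasureTheory Filter Topology
open scoped BigOperators
open Literature.Probability.LatticeModels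

/-! ### Helpers: the double family and its Fubini swap -/

/-- The double family `(z, y) ↦ f z · (m y · G (z − y))` is summable on `ℤ³ × ℤ³` as soon as `f` and
`m` are summable and `0 ≤ G ≤ 1`: it is dominated by `|f z| · |m y|`. [folklore] -/
theorem scaleId_summable_prod {m G f : Site 3 → ℝ} (hm : Summable m) (hf : Summable f)
    (hG0 : ∀ x, 0 ≤ G x) (hG1 : ∀ x, G x ≤ 1) :
    Summable (fun p : Site 3 × Site 3 => f p.1 * (m p.2 * G (p.1 - p.2))) := by
  refine Summable.of_norm_bounded
    (hf.abs.mul_of_nonneg hm.abs (fun _ => abs_nonneg _) (fun _ => abs_nonneg _)) ?_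
  intro p
  rw [Real.norm_eq_abs, abs_mul, abs_mul]
  refine mul_le_mul_of_nonneg_left ?_ (abs_nonneg _)
  calc |m p.2| * |G (p.1 - p.2)| ≤ |m p.2| * 1 := by
        refine mul_le_mul_of_nonneg_left ?_ (abs_nonneg _)
        rw [abs_of_nonneg (hG0 _)]
        exact hG1 _
    _ = |m p.2| := mul_one _

/-- Fubini for the double family: with `Σ_y m(y) G(z − y) = −δ_{z,0}`, the iterated sum
`Σ_y m(y) (Σ_z f z G(z − y))` equals `−f 0`, and `y ↦ m y · Σ_z f z G(z − y)` is summable.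
[folklore] -/
theorem scaleId_tsum_mul_smeared {m G f : Site 3 → ℝ} (hm : Summable m) (hf : Summable f)
    (hG0 : ∀ x, 0 ≤ G x) (hG1 : ∀ x, G x ≤ 1)
    (hconv : ∀ z : Site 3, (∑' y, m y * G (z - y)) = if z = 0 then -1 else 0) :
    Summable (fun y => m y * ∑' z, f z * G (z - y)) ∧
      (∑' y, m y * ∑' z, f z * G (z - y)) = -f 0 := by
  have hF := scaleId_summable_prod (f := f) hm hf hG0 hG1
  -- the `y`-fibres: `Σ_z f z (m y G(z − y)) = m y Σ_z f z G(z − y)`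
  have hfib : ∀ y, (∑' z, f z * (m y * G (z - y))) = m y * ∑' z, f z * G (z - y) := by
    intro y
    rw [← tsum_mul_left]
    exact tsum_congr fun z => by ring
  -- the `z`-fibres: `Σ_y f z (m y G(z − y)) = f z (−δ_{z,0})`
  have hfib' : ∀ z, (∑' y, f z * (m y * G (z - y))) = if z = 0 then -f z else 0 := by
    intro z
    rw [tsum_mul_left, hconv z]
    split_ifs <;> simp
  refine ⟨?_, ?_⟩
  · have h := hF.prod_symm.prod
    simp only [Prod.swap_prod_mk] at h
    simpa only [hfib] using h
  · have hunc : Summable (Function.uncurry fun z y => f z * (m y * G (z - y))) := hF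
    have hswap := hunc.tsum_comm
    -- `hswap : ∑' y, ∑' z, F z y = ∑' z, ∑' y, F z y`
    simp only [hfib, hfib'] at hswap
    rw [hswap]
    exact tsum_ite_eq (0 : Site 3) (fun z => -f z)

/-- The registered stub `stub_scaleIdentity`: the precision identity `Σ_y m(y) G(z − y) = −δ_{z,0}`
tested against the rescaled even test function `φ(·/R)` gives the scale identity
`Σ_y m(y) (Ψ(0) − Ψ(y)) = φ(0)` for the smeared kernel `Ψ(y) = Σ_z φ(z/R) G(z − y)`, the series being
summable, and `Ψ` is even. [folklore] -/
theorem stub_scaleIdentity :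
    ∀ (m G : Site 3 → ℝ) (φ : (Fin 3 → ℝ) → ℝ) (R : ℝ) (Ψ : Site 3 → ℝ),
      Summable m → (∑' y, m y) = 0 →
      (∀ x, 0 ≤ G x) → (∀ x, G x ≤ 1) → (∀ x, G (-x) = G x) →
      (∀ z : Site 3, (∑' y, m y * G (z - y)) = if z = 0 then -1 else 0) →
      (∀ v, φ (-v) = φ v) → (∀ v, |φ v| ≤ 1) → Summable (fun z : Site 3 => φ (fun i => (z i : ℝ) / R)) →
      (∀ y, Ψ y = ∑' z : Site 3, φ (fun i => (z i : ℝ) / R) * G (z - y)) →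
      Summable (fun y => m y * (Ψ 0 - Ψ y)) ∧ (∑' y, m y * (Ψ 0 - Ψ y)) = φ 0 ∧ (∀ y, Ψ (-y) = Ψ y) := by
  intro m G φ R Ψ hm hm0 hG0 hG1 hGeven hconv hφeven _hφbd hφs hΨ
  -- the rescaled test function `f z = φ(z/R)`
  set f : Site 3 → ℝ := fun z => φ (fun i => (z i : ℝ) / R) with hf_def
  have hf0 : f 0 = φ 0 := by
    simp only [hf_def, Pi.zero_apply, Int.cast_zero, zero_div]
    rfl
  have hfeven : ∀ z, f (-z) = f z := by
    intro z
    have h : (fun i => (((-z) i : ℤ) : ℝ) / R) = -(fun i => ((z i : ℤ) : ℝ) / R) := by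
      funext i
      simp [neg_div]
    simp only [hf_def]
    rw [h, hφeven]
  have hΨ' : ∀ y, Ψ y = ∑' z, f z * G (z - y) := hΨ
  obtain ⟨hsum, hval⟩ := scaleId_tsum_mul_smeared (f := f) hm hφs hG0 hG1 hconv
  have hsumΨ : Summable (fun y => m y * Ψ y) := by
    simpa only [hΨ'] using hsum
  have hvalΨ : (∑' y, m y * Ψ y) = -φ 0 := by
    rw [← hf0, ← hval]
    exact tsum_congr fun y => by rw [hΨ' y]
  refine ⟨?_, ?_, ?_⟩
  · simpa only [mul_sub] using (hm.mul_right (Ψ 0)).sub hsumΨ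
  · have h := (hm.mul_right (Ψ 0)).tsum_sub hsumΨ
    simp only [← mul_sub] at h
    rw [h, tsum_mul_right, hm0, hvalΨ]
    ring
  · intro y
    rw [hΨ' (-y), hΨ' y, ← (Equiv.neg (Site 3)).tsum_eq (fun z => f z * G (z - -y))]
    refine tsum_congr fun z => ?_
    simp only [Equiv.neg_apply, hfeven, sub_neg_eq_add]
    rw [← hGeven, neg_add_rev, neg_neg, add_comm, ← sub_eq_add_neg]

end Summit.CriticalPhenomena.Ising3DConformalLimit.Cruxes.DirectCorrelationStableTail.DiffusiveBranchIsNonsaturation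

end
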